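import Summits.BirchSwinnertonDyer.Rank1Residual.Additive.LocIrrValuationCriterionThreeProofs
import HarnessLib

/-!
# L-O6-irr is a THEOREM: `LocIrr W 3 ⟹ Δ_min ∈ (ℚ₃^{nr×})³` in its census form
# (`3 ∣ v₃(Δ_min)` and `Δ′ ≡ ±1 (mod 9)`) for EVERY elliptic curve over `ℚ` —
# `Additive.LocIrrThreeTameCube` discharged (cell `b2b-bsdres`; seat `b2b-bsdres-x11b3-p7` GEN 7 as
# CROSS-CELL POOL HAND; theorems only)

HONEST FRAMING (cell `b2b-bsdres`, run/shared/lean/b2b/bsd-rank1-residual/, verbatim in every file): the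
goal of the cell is to DELETE the COMBINATION-SHAPED residual classes of the Birch–Swinnerton-Dyer formula
for ALL analytic-rank `≤ 1` elliptic curves over `ℚ` — "full BSD formula for every rank `≤ 1` curve in
class `C`" assembled STRICTLY from published theorems — so that the rank-`≤ 1` remainder becomes exactly
the CONSTRUCTION-SHAPED classes, which are TYPED (missing-input `Prop`s), NOT attempted. This is not
"finishing BSD". Lane CLASS-CLOSURE / teams o5–o6 (O6 OPEN): research routes; census output is
EVIDENCE, never a Literature fact; nothing is booked; no mark of `RESIDUAL-MAP.md` moves. This file:
THEOREMS ONLY (no definition, no named fact, no `@[conjecture]` node, no `sorry`; net named-fact debt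
`0`); no hypothesis beyond the TARGET's own binders; no Tate algorithm, no table — pure `3`-adic
arithmetic on the integral minimal model.

## What is proved

* **`locIrrThreeTameCube_holds : LocIrrThreeTameCube`** — cc-typer-5 GEN 2/3's TARGET L-O6-irr
  (`Additive/LocIrrThreeCriteria.lean`; CENSUS 0 violations / 26 662 X4-wild rows, o6-r1 GEN 3): for
  every elliptic, globally minimal `W/ℚ`, `LocIrr W 3 → MinimalDiscIsCubeUnramifiedThree W`, i.e.
  `3 ∣ v₃(Δ_min)` (harvest-2's `three_dvd_padicValInt_minimalDiscriminantInt_of_locIrr'`, E89) AND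
  `IsPmOneModNine (minimalDiscUnitPartThree W)` — the latter is
* **`isPmOneModNine_minimalDiscUnitPartThree_of_locIrr`**: L-O56-sel (`locIrrThreeIffCriterion_holds`)
  gives the criterion `c₄ ≠ 0 ∧ (c₆ = 0 ∨ 3a + 2 ≤ 2b)` (`a, b, c = v₃ c₄, v₃ c₆, v₃ Δ_min`, read on
  `integralModelInt W` through `map_c₄` / `map_c₆` / `cast_minimalDiscriminantInt`); cc-typer-5's
  `padicValRat_Δ_of_locIrrCriterionThree` gives `3a = c + 3`; hence `c₆ = 0` or `2b ≥ c + 5`; and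
* **`isPmOneModNine_of_c_relation_int`** (pure `ℤ`): `1728·D = C₄³ − C₆²` (Mathlib `c_relation` on the
  integral model), `3·v₃C₄ = v₃D + 3`, `C₆ = 0 ∨ v₃D + 5 ≤ 2·v₃C₆` ⟹ dividing by `3^{v₃D + 3}`:
  `64·Δ′ = u³ − 9t` with `u = C₄/3^{v₃C₄}` prime to `3`, so `Δ′ ≡ 64⁻¹u³ ≡ u³ ≡ ±1 (mod 9)`
  (`isPmOneModNine_of_sixtyfour_mul_eq`, from cc-typer-5's `isPmOneModNine_pow_three`).
* Unconditional corollaries: `not_locIrr_three_of_not_isPmOneModNine'` (`Δ′ ≢ ±1 (9) ⟹ ¬ LocIrr W 3`),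
  `not_locIrr_three_of_condExp_four'` (now modulo L-O6-cyc9 `CondExpFourUnitPartLawThree` ALONE).

WORDING (EVIDENCE framing; cc-typer-5 / the o6 planners rule on any `TYPED.md` / `TARGETS.md` line):
"L-O6-irr `LocIrrThreeTameCube` is a THEOREM for all `E/ℚ` (L-O56-sel + the `c`-relation, no reduction
type assumed); census 0 / 26 662 stays EVIDENCE; L-O6-cyc9 untouched (still wants the Table II rows
IV `(3,5,6)` / II* `(5,8,12)` as tree theorems); nothing booked; no mark."

## What is NOT here

No statement about `ℚ₃(ζ₃, Δ^{1/3})` as a field (the census form `3 ∣ v ∧ Δ′ ≡ ±1 (9)` is the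
TARGET's own currency); no converse (false: `Δ_min` a cube does not force `LocIrr`); L-O6-cyc9; any
census or kit job; the `@[conjecture]` nodes of the O6 files are untouched.

References: J.-P. Serre, Invent. Math. 15 (1972) §5.3 (`ℚ(ζ₃, Δ^{1/3}) ⊂ ℚ(E[3])`)
[SerreInventiones1972]; J. E. Cremona, *Algorithms for Modular Elliptic Curves* (1997) §3.8 (`Ψ₃`)
[Cremona1997]; O. Fouquet, X. Wan, arXiv:2107.13726 Thm 5.1 (the (Lgl) bit) [FouquetWan2021];
`cells/o5o6/TARGETS.md` §O6 (o6-r1 GEN 3, `gen3/locirr_nec.out`).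
-/

noncomputable section

open scoped Classical

open WeierstrassCurve Literature.NumberTheory.EllipticCurves
  Literature.NumberTheory.EllipticCurves.Rank1Residual
  Literature.NumberTheory.EllipticCurves.Rank1Residual.Typed

namespace Summit.BirchSwinnertonDyer.Rank1Residual.Additive

/-! ## §1 The integer kernel: `64·Δ′ ≡ u³ (mod 9)` -/

/-- `64·d = u³ − 9t` with `3 ∤ u` ⟹ `d ≡ ±1 (mod 9)` (`64 ≡ 1`, cubes of units are `±1 (mod 9)`).
[folklore] -/
theorem isPmOneModNine_of_sixtyfour_mul_eq {d u t : ℤ} (hu : ¬ (3 : ℤ) ∣ u)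
    (h : 64 * d = u ^ 3 - 9 * t) : IsPmOneModNine d := by
  have hcube := isPmOneModNine_pow_three hu
  rw [isPmOneModNine_iff_zmod] at hcube ⊢
  have h' := congrArg (Int.cast : ℤ → ZMod 9) h
  push_cast at h'
  have h64 : (64 : ZMod 9) = 1 := by decide
  have h9 : (9 : ZMod 9) = 0 := by decide
  rw [h64, one_mul, h9, zero_mul, sub_zero] at h'
  push_cast at hcube
  rwa [h']

/-- **The integer kernel of L-O6-irr.** If `1728·D = C₄³ − C₆²` in `ℤ` with `C₄ ≠ 0`,
`3·v₃(C₄) = v₃(D) + 3` and (`C₆ = 0` or `v₃(D) + 5 ≤ 2·v₃(C₆)`), then the unit part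
`D / 3^{v₃ D}` is `≡ ±1 (mod 9)`: dividing the relation by `3^{v₃(D)+3}` leaves
`64·Δ′ = u³ − 9t`, `u = C₄ / 3^{v₃ C₄}` prime to `3`. [folklore] -/
theorem isPmOneModNine_of_c_relation_int {C₄ C₆ D : ℤ} (hrel : 1728 * D = C₄ ^ 3 - C₆ ^ 2)
    (hC₄ : C₄ ≠ 0) (h3a : 3 * padicValInt 3 C₄ = padicValInt 3 D + 3)
    (h2b : C₆ = 0 ∨ padicValInt 3 D + 5 ≤ 2 * padicValInt 3 C₆) :
    IsPmOneModNine (D / 3 ^ padicValInt 3 D) := by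
  set a := padicValInt 3 C₄ with ha
  set c := padicValInt 3 D with hc
  -- exact divisions
  obtain ⟨u, hu⟩ : (3 : ℤ) ^ a ∣ C₄ := by exact_mod_cast padicValInt_dvd (p := 3) C₄
  obtain ⟨d, hd⟩ : (3 : ℤ) ^ c ∣ D := by exact_mod_cast padicValInt_dvd (p := 3) D
  have h3c : (3 : ℤ) ^ c ≠ 0 := pow_ne_zero _ (by norm_num)
  have hdiv : D / 3 ^ c = d := by rw [hd, Int.mul_ediv_cancel_left _ h3c]
  rw [hdiv]
  -- `u` is prime to `3`
  have hu3 : ¬ (3 : ℤ) ∣ u := by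
    rintro ⟨u', rfl⟩
    have : (3 : ℤ) ^ (a + 1) ∣ C₄ := ⟨u', by rw [hu]; ring⟩
    have h := (padicValInt_dvd_iff (p := 3) (a + 1) C₄).mp (by exact_mod_cast this)
    rcases h with h | h
    · exact hC₄ h
    · rw [← ha] at h; omega
  -- the relation divided by `3^{c+3}`
  have h33 : (3 : ℤ) ^ (c + 3) ≠ 0 := pow_ne_zero _ (by norm_num)
  have hpow : (3 : ℤ) ^ (3 * a) = 3 ^ (c + 3) := by rw [h3a]
  rcases h2b with h6 | h2b
  · -- `C₆ = 0`: `64 d = u³`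
    refine isPmOneModNine_of_sixtyfour_mul_eq (t := 0) hu3 ?_
    apply mul_left_cancel₀ h33
    have e : (1728 : ℤ) * (3 ^ c * d) = (3 ^ a * u) ^ 3 - 0 ^ 2 := by rw [← hu, ← hd, ← h6, hrel]
    have e' : (3 : ℤ) ^ (c + 3) * (64 * d) = 3 ^ (3 * a) * u ^ 3 := by
      rw [show (3 : ℤ) ^ (c + 3) * (64 * d) = 1728 * (3 ^ c * d) by ring, e]; ring
    rw [e', hpow]; ring
  · -- `C₆ ≠ 0` branch of the valuations: `C₆² = 3^{c+5}·(…)`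
    by_cases h6 : C₆ = 0
    · refine isPmOneModNine_of_sixtyfour_mul_eq (t := 0) hu3 ?_
      apply mul_left_cancel₀ h33
      have e : (1728 : ℤ) * (3 ^ c * d) = (3 ^ a * u) ^ 3 - 0 ^ 2 := by rw [← hu, ← hd, ← h6, hrel]
      have e' : (3 : ℤ) ^ (c + 3) * (64 * d) = 3 ^ (3 * a) * u ^ 3 := by
        rw [show (3 : ℤ) ^ (c + 3) * (64 * d) = 1728 * (3 ^ c * d) by ring, e]; ring
      rw [e', hpow]; ring
    set b := padicValInt 3 C₆ with hb
    obtain ⟨w, hw⟩ : (3 : ℤ) ^ b ∣ C₆ := by exact_mod_cast padicValInt_dvd (p := 3) C₆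
    obtain ⟨s, hs⟩ : ∃ s : ℕ, 2 * b = c + 5 + s := ⟨2 * b - (c + 5), by omega⟩
    refine isPmOneModNine_of_sixtyfour_mul_eq (t := 3 ^ s * w ^ 2) hu3 ?_
    apply mul_left_cancel₀ h33
    have e : (1728 : ℤ) * (3 ^ c * d) = (3 ^ a * u) ^ 3 - (3 ^ b * w) ^ 2 := by
      rw [← hu, ← hd, ← hw, hrel]
    have e' : (3 : ℤ) ^ (c + 3) * (64 * d) = 3 ^ (3 * a) * u ^ 3 - 3 ^ (2 * b) * w ^ 2 := by
      rw [show (3 : ℤ) ^ (c + 3) * (64 * d) = 1728 * (3 ^ c * d) by ring, e]; ring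
    rw [e', hpow, hs]; ring

/-! ## §2 L-O6-irr for every elliptic curve over `ℚ` -/

section Curves

variable (W : WeierstrassCurve ℚ) [W.IsElliptic] [W.IsGloballyMinimal]

/-- **`LocIrr W 3 ⟹ Δ′ ≡ ±1 (mod 9)`** (the second conjunct of L-O6-irr, for every elliptic curve
over `ℚ`): L-O56-sel (`locIrrThreeIffCriterion_holds`) gives the valuation criterion,
`padicValRat_Δ_of_locIrrCriterionThree` gives `3a = c + 3`, the criterion then gives `2b ≥ c + 5`
(or `c₆ = 0`), and §1 reads `1728·Δ_min = c₄³ − c₆²` on the integral minimal model. [folklore] -/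
theorem isPmOneModNine_minimalDiscUnitPartThree_of_locIrr (hL : LocIrr W 3) :
    IsPmOneModNine (minimalDiscUnitPartThree W) := by
  have hcrit : LocIrrCriterionThree W := (locIrrThreeIffCriterion_holds W).mp hL
  have hvΔ := padicValRat_Δ_of_locIrrCriterionThree W hcrit
  obtain ⟨hc4, hc6⟩ := hcrit
  -- the integral minimal model
  set E := integralModelInt W with hE
  have hmap := map_integralModelInt W
  have hc₄ : W.c₄ = ((E.c₄ : ℤ) : ℚ) := by
    have h := congrArg WeierstrassCurve.c₄ hmap
    rw [map_c₄] at h; exact h.symm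
  have hc₆ : W.c₆ = ((E.c₆ : ℤ) : ℚ) := by
    have h := congrArg WeierstrassCurve.c₆ hmap
    rw [map_c₆] at h; exact h.symm
  have hΔ : W.Δ = ((W.minimalDiscriminantInt : ℤ) : ℚ) := (cast_minimalDiscriminantInt W).symm
  have hDdef : W.minimalDiscriminantInt = E.Δ := rfl
  have hC40 : E.c₄ ≠ 0 := fun h ↦ hc4 (by rw [hc₄, h, Int.cast_zero])
  -- valuations as integers
  have hva : padicValRat 3 W.c₄ = padicValInt 3 E.c₄ := by rw [hc₄, padicValRat.of_int]
  have hvb : padicValRat 3 W.c₆ = padicValInt 3 E.c₆ := by rw [hc₆, padicValRat.of_int]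
  have hvc : padicValRat 3 W.Δ = padicValInt 3 W.minimalDiscriminantInt := by
    rw [hΔ, padicValRat.of_int]
  have h3a : 3 * padicValInt 3 E.c₄ = padicValInt 3 W.minimalDiscriminantInt + 3 := by
    have h := hvΔ; rw [hva, hvc] at h; omega
  have h2b : E.c₆ = 0 ∨ padicValInt 3 W.minimalDiscriminantInt + 5 ≤ 2 * padicValInt 3 E.c₆ := by
    rcases hc6 with h0 | hle
    · left; rw [hc₆] at h0; exact_mod_cast h0
    · right; rw [hva, hvb] at hle; omega
  have hrel : 1728 * W.minimalDiscriminantInt = E.c₄ ^ 3 - E.c₆ ^ 2 := by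
    rw [hDdef]; exact E.c_relation
  exact isPmOneModNine_of_c_relation_int hrel hC40 h3a h2b

/-- **L-O6-irr `LocIrrThreeTameCube` HOLDS** (cc-typer-5's TARGET in `Additive/LocIrrThreeCriteria.lean`,
binders verbatim): for every elliptic, globally minimal `W/ℚ`, `LocIrr W 3 ⟹ 3 ∣ v₃(Δ_min) ∧ Δ′ ≡ ±1
(mod 9)` — the minimal discriminant is a cube in `ℚ₃^{nr}`. First conjunct = harvest-2's
`three_dvd_padicValInt_minimalDiscriminantInt_of_locIrr'`; second = the theorem above. CENSUS 0 / 26 662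
(o6-r1 GEN 3) stays EVIDENCE; nothing booked; no mark. [folklore] -/
theorem locIrrThreeTameCube_holds : LocIrrThreeTameCube := by
  intro W _ _ hL
  refine ⟨?_, isPmOneModNine_minimalDiscUnitPartThree_of_locIrr W hL⟩
  have h := three_dvd_padicValInt_minimalDiscriminantInt_of_locIrr' W hL
  exact_mod_cast h

/-- `Δ′ ≢ ±1 (mod 9) ⟹ E[3]|G_{ℚ₃}` reducible — `not_locIrr_three_of_not_isPmOneModNine` made
unconditional. [folklore] -/
theorem not_locIrr_three_of_not_isPmOneModNine' (hu : ¬ IsPmOneModNine (minimalDiscUnitPartThree W)) :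
    ¬ LocIrr W 3 :=
  not_locIrr_three_of_not_isPmOneModNine W locIrrThreeTameCube_holds hu

/-- `v₃N = 4 ∧ v₃Δ_min ∈ {6, 12} ⟹ ¬ LocIrr W 3`, now modulo L-O6-cyc9 ALONE. [folklore] -/
theorem not_locIrr_three_of_condExp_four' (h₂ : CondExpFourUnitPartLawThree) (hadd : Addv W 3)
    (hf : condExp W 3 = 4)
    (hv : padicValInt 3 W.minimalDiscriminantInt = 6 ∨ padicValInt 3 W.minimalDiscriminantInt = 12) :
    ¬ LocIrr W 3 :=
  not_locIrr_three_of_condExp_four W locIrrThreeTameCube_holds h₂ hadd hf hv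

end Curves

end Summit.BirchSwinnertonDyer.Rank1Residual.Additive

end
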